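import Summits.QuantumFields.YangMills.Theorems.BalabanUVNodesN19ShapeFaceN14AtRecordTV
import Summits.QuantumFields.YangMills.Theorems.BalabanUVNodesN19ShapeFaceN14AtRecord
import Summits.QuantumFields.YangMills.Theorems.BalabanUVNodesSpineReadingOfRecord13CoPH
import Summits.QuantumFields.YangMills.Theorems.BalabanUVNodesN19VacuumMGFRoad
import Literature.MathematicalPhysics.QuantumFieldTheory.Balaban1983to89.Node00.Record12MeasurabilityAbsolute

/-!
# BalabanUVNodes ∕ N14 — N14's (I)-BINDER `TiltedMeanMatching` AT THE SPINE READING OF RECORD `crOfRecord₁₃At K₀ jcut sh` (dag-n20-d p587226): the record's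
# fibre-sum class weights `weightA₁₃ ∕ weightB₁₃` ARE MGFs over the CLASS MEASURES OF RECORD; U3's read-out sentence (TV currency) on those class laws pushed to the
# unit lattice ⇒ N14's binder at the reading's carriers; with (V) the vacuum bracket and the shell split in MGF-part form ⇒ N19′'s core edge AT the reading

Cell `pub-ymgap` (HUMAN RULING D-0062 Track A; director-ym №197 ∕ HUMAN RULING D-0149 width push), WIDTH SEAT `pub-ymgap-dag-n14-w2` (g2); payload «N14 DEPENDENT on §N19 s1 ∕ U3 —
take N19-side typed sub-lemmas by name»; plan `W-SEAT-START-LIST.md` v7 §n14 w2 «the U3-face companion with n19-w2».  Filed `--kind proof --supports stmt-QuantumFields-20544 --as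
helper` (K3⁷ `SpineGivenEndpointR13SepCoPH`).  COUNT-NEUTRAL.  Imports dag-n19-w2's U3 faces `…N19ShapeFaceN14AtRecord(TV)` (p584343 ∕ p585100: `tiltedMeanMatching_of_tv_atKeys`),
dag-n20-d's `…SpineReadingOfRecord13CoPH` (`crOfRecord₁₃At`, `classSet₁₃`, `weightA₁₃ ∕ weightB₁₃`, `badClass₁₃`, §6 `core_crOfRecord₁₃At`), dag-n19-d's module 14
`…N19VacuumMGFRoad` (`coreEdge_of_coreZero_mgfForm`), MODULE B `…N19MGFFormAtRecord` (`classWeightOfDatum₉_eq_mgf_of_ppSelLive`, `isFiniteMeasure_classMeasure_dressedSlotsOfDatum₉`),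
node00-def-K0c's `Node00/Record12MeasurabilityAbsolute` (hypothesis-free (H-U) `localBgMeasurable`) — all BY NAME; edits nothing; `N`- and `K₀`-generic; no Theses import.

WHY.  Under director-ym №195 (8) reading (a) node N14 (NE1′) closes BY NAME on §N19 s1 ∕ U3: its content at the record is the DOWNSTREAM binder `DressedMGFForm.TiltedMeanMatching`
(the (I)-slot), discharged by node U3's class-level two-run sentence.  dag-n19-w2 typed that face at MODULE B's Stage-9 objects (single-sequence keys); K3⁷ v2 (plan g79,
145a664ea9c38a7b) reads the N19′ conjunct `KeyedCoreEdgeHolderD4 β cr rr` AT dag-n20-d's spine reading of record `cr := crOfRecord₁₃ jcut sh` on the live-selector line, whose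
class weights are FIBRE SUMS of F3's `classWeightOfDatum₉` over node U5d's σ-packed two-run keys and whose bad class is the persistence class `badClass₁₃ … jcut`.  The (I)-slot
of dag-n19-d's 24bᴴ `towerEdge₁₃CoPHOn_of_vacuumCoreMGFReading` (`hread`: MGF forms of the shell-free cores + `TiltedMeanMatching η`, `Summable η`, beside the vacuum `Core`) was in
NO tree file at that reading.  This file types it.
* §1 `classMeasA₁₃ ∕ classMeasB₁₃` — THE CLASS MEASURES OF RECORD (2 defs): fibre sums over `{s | keyA₁₃ … s = x}` ∕ `{s' | keyB₁₃ … s' = x}` of n19-d module A's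
  `classMeasureOfSlots … (wOfRecord₉ θ.toStage9Params) (runA₁₃ …) (histA₁₃ …) (e^{−A∕g₀²} start) (K₀+K) s` (resp. run B, `K₀+K+1`) on the runs' ORIGINAL field spaces — the
  measure-level companions of `weightA₁₃ ∕ weightB₁₃` (same fibre, same classical instances); N14's NOTE N14-ν object at the ₁₃ reading.
* §2 ★ `mgfForm_weightA₁₃` ∕ `mgfForm_weightB₁₃`: `MGFForm 1 (classSet₁₃ …) (K ↦ prodObs ((datumOfRecord₁₃CoPH F N θ hP).scheme g₀) (K₀+K) os) classMeasA₁₃ (weightA₁₃ θ hP K₀ g₀ os)`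
  AT THE LIVE SELECTOR `θ.ppSel = ppSelLiveOfRecord … E (wOfRecord₉ …)` (any `E`; K3⁷ v2's `LiveSel` is `E := EOfRecord₁₃ …`) under the displayed laws (H-ζ) `ZetaMeasurable θ.ζ`, `0 ≤ θ.ζ`
  (dag-n20-d's extraction-face hypotheses; (H-U) is K0c's absolute theorem, `w ≤ 1` the proviso row `hP.zetaAbs`); finiteness `isFiniteMeasure_classMeasA₁₃ ∕ B₁₃`.
* §3 ★★ `tiltedMeanMatching_crOfRecord₁₃At_of_tv` — THE U3 READ-OUT SENTENCE AT THE READING (hypothesis `hTV`, TV currency: on every key `x ∈ classSet₁₃ K ∖ badClass₁₃ jcut K t`,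
  `|t| ≤ 1`, every measurable `S ⊆ GaugeField (F.P 0) 0 (SU N)`, the NORMALISED masses of `S` under `classMeasB₁₃ ∕ classMeasA₁₃` pushed to the unit lattice by the canonical
  `T4RunLadder.unitFactorisation` of the tuple's own datum differ by `≤ ρ K`) ⇒ `TiltedMeanMatching (cr…).l₀ (cr…).T (cr…).Bad (prodObs … (K₀+K) os) classMeasA₁₃ (prodObs …
  (K₀+K+1) os) classMeasB₁₃ (K ↦ 4·e^{2l₀}·ρ K)` for `cr := crOfRecord₁₃At K₀ jcut sh F θ hP g₀ os` with ITS instance; `exists_tiltedMeanMatching_summable_crOfRecord₁₃At_of_tv` (`Σ ρ < ∞`).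
  (A SHAPE-density sentence gives the TV one by n19-c `N19CoreTVInvariant.tvSandwich_of_shapeSandwich`; not re-typed.)
* §4 ★★ `coreEdge_reading₁₃_of_coreZero_of_tv` ∕ `core_crOfRecord₁₃At_of_coreZero_of_tv` — N19′'s ∃δ-edge at the reading's carriers, and N19′ ∧ U4′ AT THE READING's OWN canonical
  `δ`, from (V) §N19 s1's bracket on the VACUUM shell-free cores + (SH) the shell split `sh` in MGF-PART form (`MGFForm` over sub-measures `νsh ≤ classMeas`, `MGFForm.sub`) + (I) U3's
  TV sentence on the SHELL-FREE laws; the non-negative-core letter of `core_crOfRecord₁₃At` is free here.  The rates `PHolderD4 β …` (in particular the K4 slot `N14At R.ne1`) are NOT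
  READ: on this road N14 enters K3⁷ v2's stub-2 conjunct at the reading of record ONLY through U3's sentence — reading (a) made kernel-explicit where stub 2 reads it.

HONEST FRAMING.  Count-neutral bookkeeping ([folklore] measure arithmetic + by-name composition).  ZERO ESTIMATE CONTENT: `hTV` (U3 ∕ §N19 s1's two-run class-law comparison),
(V) `h0`, and the shell split's MGF-part form `hshA ∕ hshB ∕ hleA ∕ hleB` (NODE O ∕ N21's object) are HYPOTHESIS SHAPES produced by nobody — UNPRINTED two-run statements for d = 4
([Balaban1989LargeFieldII] p.356 defers even the one-run analysis of loop observables); the live-selector pin and the laws (H-ζ) ∕ `0 ≤ ζ` are displayed, not claimed for any tuple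
(K0⁷ OPEN); nothing of Bałaban's is asserted; NE7 ∕ NE1′ NOT PRINTED as two-run statements and NOT PROVED; N14 ∕ N19 NOT discharged; K3⁷ OPEN, NOT claimed; counts UNMOVED (typed
28∕28 · discharged 5∕27, A 5∕28); one finite four-torus programme at fixed `ε = L^{−K}`, Bałaban AS PRINTED — the YM mass gap (Clay) is NOT proved by any of this: R4 closes only the
conditional finite-𝕋⁴ rung `BalabanLadder.UV`; NOT ℝ⁴, NOT OS, NOT a mass gap, NOT Clay.  2 `def` (record objects, measure level), 0 `sorry`, standard axioms, no `instance`, no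
`notation`; no decl below carries a cite tag (bookkeeping [folklore]; shape references: [Balaban1988Convergent] (2.18) p.257, [King1986] (3.10) p.656 — NAMES only).
-/

set_option autoImplicit false

noncomputable section

open MeasureTheory ProbabilityTheory Finset
open scoped ENNReal BigOperators Matrix.Norms.L2Operator

namespace YMDAG.N14.AtSpineReading13CoPH

open Literature.MathematicalPhysics.QuantumFieldTheory.Balaban1983to89
open Literature.MathematicalPhysics.QuantumFieldTheory.Balaban1983to89.T4Continuum
open Literature.MathematicalPhysics.QuantumFieldTheory.Balaban1983to89.Node00
open B14.Eq218Concrete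
open Summit.QuantumFields.BalabanUV.T4Continuum.Spine
open Summit.QuantumFields.BalabanUV.T4Continuum.NE1p.DressedMGFForm (tiltedMean MGFForm TiltedMeanMatching)
open Summit.QuantumFields.YangMills.BalabanUVNodes.N19MGFKernelTower (classMeasureOfSlots)
open Summit.QuantumFields.YangMills.BalabanUVNodes.N19MGFFormAtRecord
  (classWeightOfDatum₉_eq_mgf_of_ppSelLive isFiniteMeasure_classMeasure_dressedSlotsOfDatum₉ wOfRecord₉_nonneg wOfRecord₉_le_one)
open YMDAG.UVSplit

variable {F : T4Family} {N : ℕ} [NeZero N]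

/-! ## §1 The fibre-sum CLASS MEASURES OF RECORD of the two runs at the σ-packed keys -/

section Measures

/-- **RUN A's CLASS MEASURE OF RECORD** at step `K` and key `x`: the FIBRE SUM over the σ-packed fibre `{s | keyA₁₃ θ K₀ g₀ K s = x}` of n19-d module A's
class measures of slots `classMeasureOfSlots … (wOfRecord₉ θ) (runA₁₃ F K₀ g₀ K) (histA₁₃ θ K₀ g₀ K) (e^{−A∕g₀²} start) (K₀ + K) s` — a measure on run A's ORIGINAL
field space `GaugeField (F.P (K₀ + K)) 0 (SU N)`; the measure-level companion of dag-n20-d's `weightA₁₃` (same fibre, same classical instances). [bookkeeping] -/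
def classMeasA₁₃ (θ : Stage13HParams F N) (K₀ : ℕ) (g₀ : ℕ → ℝ) (K : ℕ) (x : Σ K, SiteSeqKey F (K₀ + K)) :
    Measure (GaugeField (F.P (K₀ + K)) 0 (Node00.SU N)) :=
  letI : ∀ Kc, DecidableEq (SiteSeqKey F Kc) := fun _ => Classical.decEq _
  ∑ s ∈ univ.filter (fun s => keyA₁₃ θ K₀ g₀ K s = x),
    classMeasureOfSlots F N θ.ν θ.τ9 (wOfRecord₉ F N θ.toStage9Params) (runA₁₃ F K₀ g₀ K) (histA₁₃ θ K₀ g₀ K)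
      (Missing.boltzmann (F.P (K₀ + K)) ((g₀ (K₀ + K))⁻¹ ^ 2)) (K₀ + K) s

/-- **RUN B's CLASS MEASURE OF RECORD** at step `K` and key `x`: the fibre sum over the block-down fibre `{s' | keyB₁₃ θ K₀ g₀ K s' = x}` of module A's class
measures of slots of run B (`K₀ + K + 1` steps) — on `GaugeField (F.P (K₀ + K + 1)) 0 (SU N)`; the companion of `weightB₁₃`. [bookkeeping] -/
def classMeasB₁₃ (θ : Stage13HParams F N) (K₀ : ℕ) (g₀ : ℕ → ℝ) (K : ℕ) (x : Σ K, SiteSeqKey F (K₀ + K)) :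
    Measure (GaugeField (F.P (K₀ + K + 1)) 0 (Node00.SU N)) :=
  letI : ∀ Kc, DecidableEq (SiteSeqKey F Kc) := fun _ => Classical.decEq _
  ∑ s' ∈ univ.filter (fun s' => keyB₁₃ θ K₀ g₀ K s' = x),
    classMeasureOfSlots F N θ.ν θ.τ9 (wOfRecord₉ F N θ.toStage9Params) (runB₁₃ F K₀ g₀ K) (histB₁₃ θ K₀ g₀ K)
      (Missing.boltzmann (F.P (K₀ + K + 1)) ((g₀ (K₀ + K + 1))⁻¹ ^ 2)) (K₀ + K + 1) s'

end Measures

/-- A finite sum of finite measures is finite (Mathlib's instance, as a term for `exact` — the fibre sums' summand types agree with the carrier only up to unfolding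
`runA₁₃ ∕ runB₁₃`, so instance SEARCH does not see them). [folklore] -/
theorem isFiniteMeasure_finsetSum {α σ : Type*} {_ : MeasurableSpace α} (S : Finset σ) (μ : σ → Measure α) [h : ∀ s, IsFiniteMeasure (μ s)] :
    IsFiniteMeasure (∑ s ∈ S, μ s) :=
  inferInstance

/-! ## §2 `MGFForm` of the record's fibre-sum class weights over the class measures of record (live selector, three laws) -/

section MGF

variable (θ : Stage13HParams F N) (K₀ : ℕ)

/-- Every class measure of slots of run A of record is FINITE (module A's mass bound; law `w ≤ 1` from the proviso row `hP.zetaAbs`, measurability from K0c's absolute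
(H-U) `localBgMeasurable` + the displayed (H-ζ) `ZetaMeasurable`). [bookkeeping] -/
theorem isFiniteMeasure_classMeasureOfSlots_runA₁₃ (hP : θ.Provisos₁₃CoPH F N) (hζm : ZetaMeasurable F N θ.ζ) (g₀ : ℕ → ℝ) (K : ℕ)
    (s : SeqOfRecord F θ.ν θ.τ9.M (histA₁₃ θ K₀ g₀ K) (K₀ + K) (K₀ + K)) :
    IsFiniteMeasure (α := GaugeField (F.P (K₀ + K)) 0 (Node00.SU N))
      (classMeasureOfSlots F N θ.ν θ.τ9 (wOfRecord₉ F N θ.toStage9Params) (runA₁₃ F K₀ g₀ K) (histA₁₃ θ K₀ g₀ K)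
        (Missing.boltzmann (F.P (K₀ + K)) ((g₀ (K₀ + K))⁻¹ ^ 2)) (K₀ + K) s) :=
  isFiniteMeasure_classMeasure_dressedSlotsOfDatum₉ θ.toStage9Params (p := runA₁₃ F K₀ g₀ K) (g := histA₁₃ θ K₀ g₀ K)
    (wOfRecord₉_le_one _ hP.zetaAbs _ _)
    (fun k s' => measurable_wOfRecord_of_localBg (localBgMeasurable F N θ.ν) _ _ hζm _ _ k s')
    (fun k s => measurable_chiSeqOfRecord_of_localBg (localBgMeasurable F N θ.ν) _ _ _ k s) g₀ (K₀ + K) s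

/-- … and of run B of record. [bookkeeping] -/
theorem isFiniteMeasure_classMeasureOfSlots_runB₁₃ (hP : θ.Provisos₁₃CoPH F N) (hζm : ZetaMeasurable F N θ.ζ) (g₀ : ℕ → ℝ) (K : ℕ)
    (s' : SeqOfRecord F θ.ν θ.τ9.M (histB₁₃ θ K₀ g₀ K) (K₀ + K + 1) (K₀ + K + 1)) :
    IsFiniteMeasure (α := GaugeField (F.P (K₀ + K + 1)) 0 (Node00.SU N))
      (classMeasureOfSlots F N θ.ν θ.τ9 (wOfRecord₉ F N θ.toStage9Params) (runB₁₃ F K₀ g₀ K) (histB₁₃ θ K₀ g₀ K)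
        (Missing.boltzmann (F.P (K₀ + K + 1)) ((g₀ (K₀ + K + 1))⁻¹ ^ 2)) (K₀ + K + 1) s') :=
  isFiniteMeasure_classMeasure_dressedSlotsOfDatum₉ θ.toStage9Params (p := runB₁₃ F K₀ g₀ K) (g := histB₁₃ θ K₀ g₀ K)
    (wOfRecord₉_le_one _ hP.zetaAbs _ _)
    (fun k s' => measurable_wOfRecord_of_localBg (localBgMeasurable F N θ.ν) _ _ hζm _ _ k s')
    (fun k s => measurable_chiSeqOfRecord_of_localBg (localBgMeasurable F N θ.ν) _ _ _ k s) g₀ (K₀ + K + 1) s'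

/-- Run A's class measures of record are FINITE. [bookkeeping] -/
theorem isFiniteMeasure_classMeasA₁₃ (hP : θ.Provisos₁₃CoPH F N) (hζm : ZetaMeasurable F N θ.ζ) (g₀ : ℕ → ℝ) (K : ℕ) (x : Σ K, SiteSeqKey F (K₀ + K)) :
    IsFiniteMeasure (classMeasA₁₃ θ K₀ g₀ K x) := by
  unfold classMeasA₁₃
  exact @isFiniteMeasure_finsetSum _ _ _ _ _ (isFiniteMeasure_classMeasureOfSlots_runA₁₃ θ K₀ hP hζm g₀ K)

/-- Run B's class measures of record are FINITE. [bookkeeping] -/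
theorem isFiniteMeasure_classMeasB₁₃ (hP : θ.Provisos₁₃CoPH F N) (hζm : ZetaMeasurable F N θ.ζ) (g₀ : ℕ → ℝ) (K : ℕ) (x : Σ K, SiteSeqKey F (K₀ + K)) :
    IsFiniteMeasure (classMeasB₁₃ θ K₀ g₀ K x) := by
  unfold classMeasB₁₃
  exact @isFiniteMeasure_finsetSum _ _ _ _ _ (isFiniteMeasure_classMeasureOfSlots_runB₁₃ θ K₀ hP hζm g₀ K)

/-- The run-A observable of record `prodObs ((datumOfRecord₁₃CoPH F N θ hP).scheme g₀) k os` is measurable (B1 `isPrintedAveraged_datumOfRecord₁₃CoPH` ⇒ measurable averagings). [bookkeeping] -/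
theorem measurable_prodObs_datumOfRecord₁₃CoPH (hP : θ.Provisos₁₃CoPH F N) (g₀ : ℕ → ℝ) (os : List (ULoop F)) (k : ℕ) :
    Measurable (fun U : GaugeField (F.P k) 0 (Node00.SU N) => T4GenFunBounds.prodObs ((datumOfRecord₁₃CoPH F N θ hP).scheme g₀) k os U) :=
  T4GenFunBounds.measurable_prodObs ((datumOfRecord₁₃CoPH F N θ hP).scheme g₀)
    (fun K o => (datumOfRecord₁₃CoPH F N θ hP).measurable_avgObs (isPrintedAveraged_datumOfRecord₁₃CoPH F N θ hP).avgMeasurable K o) k os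

/-- … and bounded by `1`. [bookkeeping] -/
theorem abs_prodObs_datumOfRecord₁₃CoPH_le_one (hP : θ.Provisos₁₃CoPH F N) (g₀ : ℕ → ℝ) (os : List (ULoop F)) (k : ℕ)
    (U : GaugeField (F.P k) 0 (Node00.SU N)) : |T4GenFunBounds.prodObs ((datumOfRecord₁₃CoPH F N θ hP).scheme g₀) k os U| ≤ 1 :=
  T4GenFunBounds.abs_prodObs_le_one ((datumOfRecord₁₃CoPH F N θ hP).scheme g₀)
    (fun K o U => (datumOfRecord₁₃CoPH F N θ hP).abs_avgObs_le_one K o U) k os U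

/-- **★ `MGFForm` OF RUN A's FIBRE-SUM CLASS WEIGHTS OF RECORD `weightA₁₃`** over the class measures of record, observable `prodObs ((datumOfRecord₁₃CoPH F N θ hP).scheme g₀)
(K₀ + K) os` (`Bo = 1`), classes `classSet₁₃ θ K₀ g₀` — AT THE LIVE SELECTOR `θ.ppSel = ppSelLiveOfRecord … E (wOfRecord₉ …)` (any normalisation `E`; K3⁷ v2's `LiveSel` is
`E := EOfRecord₁₃ …`), under the displayed laws (H-ζ) `ZetaMeasurable θ.ζ` and `0 ≤ θ.ζ` ((H-U) is K0c's absolute `localBgMeasurable`; `w ≤ 1` is the proviso row `hP.zetaAbs`):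
MODULE B's `classWeightOfDatum₉_eq_mgf_of_ppSelLive` per sequence (`histA₁₃_zero`: the history starts at the dressing's coupling) + `integral_finsetSum_measure` over the
σ-packed fibre. [bookkeeping] -/
theorem mgfForm_weightA₁₃ (hP : θ.Provisos₁₃CoPH F N) (E : B12.RunParams → ℝ)
    (hsel : θ.ppSel = ppSelLiveOfRecord F N θ.ν θ.τ9 E (wOfRecord₉ F N θ.toStage9Params))
    (hζm : ZetaMeasurable F N θ.ζ) (hζ0 : ∀ p g k s Pl Ql RS U V', 0 ≤ θ.ζ p g k s Pl Ql RS U V') (g₀ : ℕ → ℝ) (os : List (ULoop F)) :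
    MGFForm 1 (classSet₁₃ θ K₀ g₀)
      (fun K (U : GaugeField (F.P (K₀ + K)) 0 (Node00.SU N)) => T4GenFunBounds.prodObs ((datumOfRecord₁₃CoPH F N θ hP).scheme g₀) (K₀ + K) os U)
      (classMeasA₁₃ θ K₀ g₀) (weightA₁₃ θ hP K₀ g₀ os) where
  nonneg := zero_le_one
  meas K := measurable_prodObs_datumOfRecord₁₃CoPH θ hP g₀ os (K₀ + K)
  bound K ω := abs_prodObs_datumOfRecord₁₃CoPH_le_one θ hP g₀ os (K₀ + K) ω
  finite K x _ := isFiniteMeasure_classMeasA₁₃ θ K₀ hP hζm g₀ K x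
  repr K t x _ := by
    letI : ∀ Kc, DecidableEq (SiteSeqKey F Kc) := fun _ => Classical.decEq _
    have hU := localBgMeasurable F N θ.ν
    have hint : ∀ s ∈ univ.filter (fun s => keyA₁₃ θ K₀ g₀ K s = x),
        Integrable (fun ω : GaugeField (F.P (K₀ + K)) 0 (Node00.SU N) =>
            Real.exp (t * T4GenFunBounds.prodObs ((datumOfRecord₁₃CoPH F N θ hP).scheme g₀) (K₀ + K) os ω))
          (classMeasureOfSlots F N θ.ν θ.τ9 (wOfRecord₉ F N θ.toStage9Params) (runA₁₃ F K₀ g₀ K) (histA₁₃ θ K₀ g₀ K)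
            (Missing.boltzmann (F.P (K₀ + K)) ((g₀ (K₀ + K))⁻¹ ^ 2)) (K₀ + K) s) := fun s _ =>
      @T4GenFunBounds.integrable_exp_mul_of_bound _ _ _ _ _ (isFiniteMeasure_classMeasureOfSlots_runA₁₃ θ K₀ hP hζm g₀ K s)
        (measurable_prodObs_datumOfRecord₁₃CoPH θ hP g₀ os (K₀ + K)).aemeasurable
        (ae_of_all _ (abs_prodObs_datumOfRecord₁₃CoPH_le_one θ hP g₀ os (K₀ + K))) t
    unfold weightA₁₃ classMeasA₁₃
    refine (Finset.sum_congr rfl fun s _ => ?_).trans (integral_finsetSum_measure hint).symm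
    exact classWeightOfDatum₉_eq_mgf_of_ppSelLive θ.toStage9Params E hsel (histA₁₃_zero θ K₀ g₀ K) (wOfRecord₉_nonneg _ hζ0 _ _)
      (fun k s' => measurable_wOfRecord_of_localBg hU _ _ hζm _ _ k s') (fun k s => measurable_chiSeqOfRecord_of_localBg hU _ _ _ k s)
      (datumOfRecord₁₃CoPH F N θ hP) (isPrintedAveraged_datumOfRecord₁₃CoPH F N θ hP).avgMeasurable os (K₀ + K) t s

/-- **★ `MGFForm` OF RUN B's FIBRE-SUM CLASS WEIGHTS OF RECORD `weightB₁₃`** (run `K₀ + K + 1`, block-down fibre of `keyB₁₃`), observable `prodObs (…) (K₀ + K + 1) os`, same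
selector pin and laws (`histB₁₃_zero`). [bookkeeping] -/
theorem mgfForm_weightB₁₃ (hP : θ.Provisos₁₃CoPH F N) (E : B12.RunParams → ℝ)
    (hsel : θ.ppSel = ppSelLiveOfRecord F N θ.ν θ.τ9 E (wOfRecord₉ F N θ.toStage9Params))
    (hζm : ZetaMeasurable F N θ.ζ) (hζ0 : ∀ p g k s Pl Ql RS U V', 0 ≤ θ.ζ p g k s Pl Ql RS U V') (g₀ : ℕ → ℝ) (os : List (ULoop F)) :
    MGFForm 1 (classSet₁₃ θ K₀ g₀)
      (fun K (U : GaugeField (F.P (K₀ + K + 1)) 0 (Node00.SU N)) => T4GenFunBounds.prodObs ((datumOfRecord₁₃CoPH F N θ hP).scheme g₀) (K₀ + K + 1) os U)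
      (classMeasB₁₃ θ K₀ g₀) (weightB₁₃ θ hP K₀ g₀ os) where
  nonneg := zero_le_one
  meas K := measurable_prodObs_datumOfRecord₁₃CoPH θ hP g₀ os (K₀ + K + 1)
  bound K ω := abs_prodObs_datumOfRecord₁₃CoPH_le_one θ hP g₀ os (K₀ + K + 1) ω
  finite K x _ := isFiniteMeasure_classMeasB₁₃ θ K₀ hP hζm g₀ K x
  repr K t x _ := by
    letI : ∀ Kc, DecidableEq (SiteSeqKey F Kc) := fun _ => Classical.decEq _
    have hU := localBgMeasurable F N θ.ν
    have hint : ∀ s ∈ univ.filter (fun s => keyB₁₃ θ K₀ g₀ K s = x),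
        Integrable (fun ω : GaugeField (F.P (K₀ + K + 1)) 0 (Node00.SU N) =>
            Real.exp (t * T4GenFunBounds.prodObs ((datumOfRecord₁₃CoPH F N θ hP).scheme g₀) (K₀ + K + 1) os ω))
          (classMeasureOfSlots F N θ.ν θ.τ9 (wOfRecord₉ F N θ.toStage9Params) (runB₁₃ F K₀ g₀ K) (histB₁₃ θ K₀ g₀ K)
            (Missing.boltzmann (F.P (K₀ + K + 1)) ((g₀ (K₀ + K + 1))⁻¹ ^ 2)) (K₀ + K + 1) s) := fun s _ =>
      @T4GenFunBounds.integrable_exp_mul_of_bound _ _ _ _ _ (isFiniteMeasure_classMeasureOfSlots_runB₁₃ θ K₀ hP hζm g₀ K s)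
        (measurable_prodObs_datumOfRecord₁₃CoPH θ hP g₀ os (K₀ + K + 1)).aemeasurable
        (ae_of_all _ (abs_prodObs_datumOfRecord₁₃CoPH_le_one θ hP g₀ os (K₀ + K + 1))) t
    unfold weightB₁₃ classMeasB₁₃
    refine (Finset.sum_congr rfl fun s _ => ?_).trans (integral_finsetSum_measure hint).symm
    exact classWeightOfDatum₉_eq_mgf_of_ppSelLive θ.toStage9Params E hsel (histB₁₃_zero θ K₀ g₀ K) (wOfRecord₉_nonneg _ hζ0 _ _)
      (fun k s' => measurable_wOfRecord_of_localBg hU _ _ hζm _ _ k s') (fun k s => measurable_chiSeqOfRecord_of_localBg hU _ _ _ k s)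
      (datumOfRecord₁₃CoPH F N θ hP) (isPrintedAveraged_datumOfRecord₁₃CoPH F N θ hP).avgMeasurable os (K₀ + K + 1) t s

end MGF

/-! ## §3 ★ N14's BINDER AT THE SPINE READING OF RECORD from U3's read-out sentence (TV ∕ SHAPE currency) on the class laws of record pushed to the unit lattice -/

section Binder

open Summit.QuantumFields.YangMills.BalabanUVNodes.N19ShapeFaceN14AtRecordTV (tiltedMeanMatching_of_tv_atKeys)
open Summit.QuantumFields.YangMills.BalabanUVNodes.N19ShapeFaceN14AtRecord (tiltedMeanMatching_of_shapeDensity_atKeys summable_mul_exp_two_mul_sub_one)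

variable (θ : Stage13HParams F N) (hP : θ.Provisos₁₃CoPH F N) (K₀ : ℕ) (jcut : ℕ → ℕ) (sh : ShellSplit₁₃CoPH N K₀)

/-- **★★ THE U3 READ-OUT SENTENCE, TV CURRENCY, AT THE SPINE READING OF RECORD ⇒ N14's BINDER AT THE READING's CARRIERS** [bookkeeping].  DISPLAYED HYPOTHESIS `hTV` (produced
by nobody — node U3 ∕ §N19 s1's world): for every `K`, every source `|t| ≤ 1 = (cr…).l₀`, every key `x` of the class set of record good under the persistence policy `jcut`
(`x ∈ classSet₁₃ θ K₀ g₀ K ∖ badClass₁₃ θ K₀ g₀ jcut K t`) and every measurable set `S` of unit-lattice fields `GaugeField (F.P 0) 0 (SU N)`: the NORMALISED masses of `S` under the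
two runs' CLASS MEASURES OF RECORD pushed to the unit lattice by the canonical `T4RunLadder.unitFactorisation` of the tuple's own datum (`A_{K₀+K+1}` ∕ `A_{K₀+K}`) differ by at most
`ρ K` (a massless class reads `0`).  CONCLUSION: `TiltedMeanMatching` for the READING's `l₀ ∕ T ∕ Bad` (dag-n20-d's `crOfRecord₁₃At K₀ jcut sh …`, ITS classical instance), the
record's unit-scale observables `prodObs ((datumOfRecord₁₃CoPH …).scheme g₀) (K₀+K) os` ∕ `(K₀+K+1)` on the runs' OWN field spaces and the class measures of record, with
`η K = 4·e^{2·l₀}·ρ K` — the `Fo ν Fo' ν' η` slots of 24bᴴ `towerEdge₁₃CoPHOn_of_vacuumCoreMGFReading`'s `hread` at `cr := crOfRecord₁₃At K₀ jcut sh`.  n19-w2's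
`tiltedMeanMatching_of_tv_atKeys` BY NAME (finiteness from §2; laws: (H-ζ) displayed, (H-U) absolute, `w ≤ 1` = `hP.zetaAbs`). [folklore] -/
theorem tiltedMeanMatching_crOfRecord₁₃At_of_tv (hζm : ZetaMeasurable F N θ.ζ) (g₀ : ℕ → ℝ) (os : List (ULoop F)) {ρ : ℕ → ℝ}
    (hTV : letI : DecidableEq (Σ K, SiteSeqKey F (K₀ + K)) := Classical.decEq _
      ∀ (K : ℕ) (t : ℝ), |t| ≤ 1 → ∀ x ∈ classSet₁₃ θ K₀ g₀ K \ badClass₁₃ θ K₀ g₀ jcut K t, ∀ S : Set (GaugeField (F.P 0) 0 (Node00.SU N)), MeasurableSet S →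
        |((classMeasB₁₃ θ K₀ g₀ K x).map
              ((T4RunLadder.unitFactorisation (datumOfRecord₁₃CoPH F N θ hP) (isPrintedAveraged_datumOfRecord₁₃CoPH F N θ hP).avgMeasurable g₀).A (K₀ + K + 1))).real S /
            ((classMeasB₁₃ θ K₀ g₀ K x).map
              ((T4RunLadder.unitFactorisation (datumOfRecord₁₃CoPH F N θ hP) (isPrintedAveraged_datumOfRecord₁₃CoPH F N θ hP).avgMeasurable g₀).A (K₀ + K + 1))).real Set.univ -
          ((classMeasA₁₃ θ K₀ g₀ K x).map
              ((T4RunLadder.unitFactorisation (datumOfRecord₁₃CoPH F N θ hP) (isPrintedAveraged_datumOfRecord₁₃CoPH F N θ hP).avgMeasurable g₀).A (K₀ + K))).real S /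
            ((classMeasA₁₃ θ K₀ g₀ K x).map
              ((T4RunLadder.unitFactorisation (datumOfRecord₁₃CoPH F N θ hP) (isPrintedAveraged_datumOfRecord₁₃CoPH F N θ hP).avgMeasurable g₀).A (K₀ + K))).real Set.univ| ≤
          ρ K) :
    letI := (crOfRecord₁₃At K₀ jcut sh F θ hP g₀ os).dec
    TiltedMeanMatching (crOfRecord₁₃At K₀ jcut sh F θ hP g₀ os).l₀ (crOfRecord₁₃At K₀ jcut sh F θ hP g₀ os).T (crOfRecord₁₃At K₀ jcut sh F θ hP g₀ os).Bad
      (fun K (U : GaugeField (F.P (K₀ + K)) 0 (Node00.SU N)) => T4GenFunBounds.prodObs ((datumOfRecord₁₃CoPH F N θ hP).scheme g₀) (K₀ + K) os U) (classMeasA₁₃ θ K₀ g₀)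
      (fun K (U : GaugeField (F.P (K₀ + K + 1)) 0 (Node00.SU N)) => T4GenFunBounds.prodObs ((datumOfRecord₁₃CoPH F N θ hP).scheme g₀) (K₀ + K + 1) os U) (classMeasB₁₃ θ K₀ g₀)
      fun K => 4 * Real.exp (2 * (crOfRecord₁₃At K₀ jcut sh F θ hP g₀ os).l₀) * ρ K := by
  letI : DecidableEq (Σ K, SiteSeqKey F (K₀ + K)) := Classical.decEq _
  have h := tiltedMeanMatching_of_tv_atKeys (T := classSet₁₃ θ K₀ g₀) (Bad := badClass₁₃ θ K₀ g₀ jcut) (l₀ := 1) (ρ := ρ)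
    (kA := fun K => K₀ + K) (kB := fun K => K₀ + K + 1) (νA := classMeasA₁₃ θ K₀ g₀) (νB := classMeasB₁₃ θ K₀ g₀)
    (T4RunLadder.unitFactorisation (datumOfRecord₁₃CoPH F N θ hP) (isPrintedAveraged_datumOfRecord₁₃CoPH F N θ hP).avgMeasurable g₀) os
    (fun K x _ => isFiniteMeasure_classMeasA₁₃ θ K₀ hP hζm g₀ K x) (fun K x _ => isFiniteMeasure_classMeasB₁₃ θ K₀ hP hζm g₀ K x) hTV
  intro K t ht x hx u hu
  exact h K t ht x hx u hu

/-- **… WITH A SUMMABLE MAJORANT — THE (I)-SLOT PAIR AT THE READING** [bookkeeping]: `Σ ρ K < ∞` ⇒ `∃ η, TiltedMeanMatching (cr…).l₀ (cr…).T (cr…).Bad Fo ν Fo' ν' η ∧ Summable η`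
for the record's observables and class measures of record — the `η` slots of 24bᴴ's `hread` (`cr := crOfRecord₁₃At K₀ jcut sh`). [folklore] -/
theorem exists_tiltedMeanMatching_summable_crOfRecord₁₃At_of_tv (hζm : ZetaMeasurable F N θ.ζ) (g₀ : ℕ → ℝ) (os : List (ULoop F)) {ρ : ℕ → ℝ}
    (hTV : letI : DecidableEq (Σ K, SiteSeqKey F (K₀ + K)) := Classical.decEq _
      ∀ (K : ℕ) (t : ℝ), |t| ≤ 1 → ∀ x ∈ classSet₁₃ θ K₀ g₀ K \ badClass₁₃ θ K₀ g₀ jcut K t, ∀ S : Set (GaugeField (F.P 0) 0 (Node00.SU N)), MeasurableSet S →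
        |((classMeasB₁₃ θ K₀ g₀ K x).map
              ((T4RunLadder.unitFactorisation (datumOfRecord₁₃CoPH F N θ hP) (isPrintedAveraged_datumOfRecord₁₃CoPH F N θ hP).avgMeasurable g₀).A (K₀ + K + 1))).real S /
            ((classMeasB₁₃ θ K₀ g₀ K x).map
              ((T4RunLadder.unitFactorisation (datumOfRecord₁₃CoPH F N θ hP) (isPrintedAveraged_datumOfRecord₁₃CoPH F N θ hP).avgMeasurable g₀).A (K₀ + K + 1))).real Set.univ -
          ((classMeasA₁₃ θ K₀ g₀ K x).map
              ((T4RunLadder.unitFactorisation (datumOfRecord₁₃CoPH F N θ hP) (isPrintedAveraged_datumOfRecord₁₃CoPH F N θ hP).avgMeasurable g₀).A (K₀ + K))).real S /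
            ((classMeasA₁₃ θ K₀ g₀ K x).map
              ((T4RunLadder.unitFactorisation (datumOfRecord₁₃CoPH F N θ hP) (isPrintedAveraged_datumOfRecord₁₃CoPH F N θ hP).avgMeasurable g₀).A (K₀ + K))).real Set.univ| ≤
          ρ K)
    (hρs : Summable ρ) :
    letI := (crOfRecord₁₃At K₀ jcut sh F θ hP g₀ os).dec
    ∃ η : ℕ → ℝ, TiltedMeanMatching (crOfRecord₁₃At K₀ jcut sh F θ hP g₀ os).l₀ (crOfRecord₁₃At K₀ jcut sh F θ hP g₀ os).T (crOfRecord₁₃At K₀ jcut sh F θ hP g₀ os).Bad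
      (fun K (U : GaugeField (F.P (K₀ + K)) 0 (Node00.SU N)) => T4GenFunBounds.prodObs ((datumOfRecord₁₃CoPH F N θ hP).scheme g₀) (K₀ + K) os U) (classMeasA₁₃ θ K₀ g₀)
      (fun K (U : GaugeField (F.P (K₀ + K + 1)) 0 (Node00.SU N)) => T4GenFunBounds.prodObs ((datumOfRecord₁₃CoPH F N θ hP).scheme g₀) (K₀ + K + 1) os U) (classMeasB₁₃ θ K₀ g₀)
      η ∧ Summable η :=
  ⟨_, tiltedMeanMatching_crOfRecord₁₃At_of_tv θ hP K₀ jcut sh hζm g₀ os hTV, hρs.mul_left _⟩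

end Binder

/-! ## §4 ★★ N19′'s CORE EDGE AT THE SPINE READING OF RECORD from (V) the vacuum bracket + (I) U3's TV sentence on the SHELL-FREE class laws + the shell split in MGF-part form -/

section Edge

open Summit.QuantumFields.YangMills.BalabanUVNodes.N19ShapeFaceN14AtRecordTV (tiltedMeanMatching_of_tv_atKeys)
open Summit.QuantumFields.YangMills.BalabanUVNodes.N19VacuumMGFRoad (coreEdge_of_coreZero_mgfForm)

variable (θ : Stage13HParams F N) (hP : θ.Provisos₁₃CoPH F N) (K₀ : ℕ) (jcut : ℕ → ℕ) (sh : ShellSplit₁₃CoPH N K₀)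

/-- **★★ N19′'s ∃δ-EDGE AT THE READING's CARRIERS FROM (V) + (I) + THE SHELL SPLIT's MGF-PART FORM** [bookkeeping].  At one Stage-13 tuple with core provisos on the
LIVE-SELECTOR line (`hsel`; laws (H-ζ) `hζm`, `hζ0`), DISPLAYED HYPOTHESES — each produced by nobody: (V) `h0` = §N19 s1's bracket ON THE VACUUM CORES: the undressed (`t = 0`)
shell-free class weights of record `weightA₁₃ − sh.1`, `weightB₁₃ − sh.2` carry `NE7.Core 1 1 (classSet₁₃ …) (badClass₁₃ … jcut) … δ₀` with `Summable δ₀`; (SH) the shell split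
`sh` (NODE O ∕ N21's object) IS IN MGF-PART FORM: its two components are the MGFs of the record's observables over SUB-measures `νshA ≤ classMeasA₁₃`, `νshB ≤ classMeasB₁₃` of the
class measures of record (a shell part of a term is the total of a sub-family of its integrand — `DressedMGFForm.MGFForm.sub`); (I) = U3's READ-OUT SENTENCE, TV currency, for the
SHELL-FREE class laws `classMeasB₁₃ − νshB` ∕ `classMeasA₁₃ − νshA` pushed to the unit lattice, width `ρ K`, `Σ ρ K < ∞`.  CONCLUSION: the ∃δ-edge
`∃ δ, NE7.Core 1 1 (classSet₁₃ …) (badClass₁₃ … jcut) (weightA₁₃ − sh.1) (weightB₁₃ − sh.2) δ ∧ Summable δ` (`δ = δ₀ + 4e²·ρ`) — dag-n20-d's `core_crOfRecord₁₃At`'s hypothesis pair,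
i.e. the body of K3⁷ v2's `KeyedCoreEdgeHolderD4 β (crOfRecord₁₃ jcut sh) rr` at the tuple with the rates `PHolderD4 β …` NOT READ: on this road N14 enters the N19′ conjunct ONLY
through U3's sentence (director-ym №195 (8) reading (a), kernel-explicit).  §2 + `MGFForm.sub` + n19-w2 `tiltedMeanMatching_of_tv_atKeys` + n19-d `coreEdge_of_coreZero_mgfForm`
BY NAME. [folklore] -/
theorem coreEdge_reading₁₃_of_coreZero_of_tv (E : B12.RunParams → ℝ) (hsel : θ.ppSel = ppSelLiveOfRecord F N θ.ν θ.τ9 E (wOfRecord₉ F N θ.toStage9Params))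
    (hζm : ZetaMeasurable F N θ.ζ) (hζ0 : ∀ p g k s Pl Ql RS U V', 0 ≤ θ.ζ p g k s Pl Ql RS U V') (g₀ : ℕ → ℝ) (os : List (ULoop F)) {δ₀ ρ : ℕ → ℝ}
    (h0 : letI : DecidableEq (Σ K, SiteSeqKey F (K₀ + K)) := Classical.decEq _
      NE7.Core 1 1 (classSet₁₃ θ K₀ g₀) (badClass₁₃ θ K₀ g₀ jcut) (fun K _ x => weightA₁₃ θ hP K₀ g₀ os K 0 x - (sh F θ hP g₀ os).1 K 0 x)
        (fun K _ x => weightB₁₃ θ hP K₀ g₀ os K 0 x - (sh F θ hP g₀ os).2 K 0 x) δ₀)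
    (hδ₀ : Summable δ₀)
    {νshA : ∀ K, (Σ K, SiteSeqKey F (K₀ + K)) → Measure (GaugeField (F.P (K₀ + K)) 0 (Node00.SU N))}
    {νshB : ∀ K, (Σ K, SiteSeqKey F (K₀ + K)) → Measure (GaugeField (F.P (K₀ + K + 1)) 0 (Node00.SU N))}
    (hshA : MGFForm 1 (classSet₁₃ θ K₀ g₀)
      (fun K (U : GaugeField (F.P (K₀ + K)) 0 (Node00.SU N)) => T4GenFunBounds.prodObs ((datumOfRecord₁₃CoPH F N θ hP).scheme g₀) (K₀ + K) os U) νshA (sh F θ hP g₀ os).1)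
    (hleA : ∀ K, ∀ x ∈ classSet₁₃ θ K₀ g₀ K, νshA K x ≤ classMeasA₁₃ θ K₀ g₀ K x)
    (hshB : MGFForm 1 (classSet₁₃ θ K₀ g₀)
      (fun K (U : GaugeField (F.P (K₀ + K + 1)) 0 (Node00.SU N)) => T4GenFunBounds.prodObs ((datumOfRecord₁₃CoPH F N θ hP).scheme g₀) (K₀ + K + 1) os U) νshB (sh F θ hP g₀ os).2)
    (hleB : ∀ K, ∀ x ∈ classSet₁₃ θ K₀ g₀ K, νshB K x ≤ classMeasB₁₃ θ K₀ g₀ K x)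
    (hTV : letI : DecidableEq (Σ K, SiteSeqKey F (K₀ + K)) := Classical.decEq _
      ∀ (K : ℕ) (t : ℝ), |t| ≤ 1 → ∀ x ∈ classSet₁₃ θ K₀ g₀ K \ badClass₁₃ θ K₀ g₀ jcut K t, ∀ S : Set (GaugeField (F.P 0) 0 (Node00.SU N)), MeasurableSet S →
        |((classMeasB₁₃ θ K₀ g₀ K x - νshB K x).map
              ((T4RunLadder.unitFactorisation (datumOfRecord₁₃CoPH F N θ hP) (isPrintedAveraged_datumOfRecord₁₃CoPH F N θ hP).avgMeasurable g₀).A (K₀ + K + 1))).real S /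
            ((classMeasB₁₃ θ K₀ g₀ K x - νshB K x).map
              ((T4RunLadder.unitFactorisation (datumOfRecord₁₃CoPH F N θ hP) (isPrintedAveraged_datumOfRecord₁₃CoPH F N θ hP).avgMeasurable g₀).A (K₀ + K + 1))).real Set.univ -
          ((classMeasA₁₃ θ K₀ g₀ K x - νshA K x).map
              ((T4RunLadder.unitFactorisation (datumOfRecord₁₃CoPH F N θ hP) (isPrintedAveraged_datumOfRecord₁₃CoPH F N θ hP).avgMeasurable g₀).A (K₀ + K))).real S /
            ((classMeasA₁₃ θ K₀ g₀ K x - νshA K x).map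
              ((T4RunLadder.unitFactorisation (datumOfRecord₁₃CoPH F N θ hP) (isPrintedAveraged_datumOfRecord₁₃CoPH F N θ hP).avgMeasurable g₀).A (K₀ + K))).real Set.univ| ≤
          ρ K)
    (hρs : Summable ρ) :
    letI : DecidableEq (Σ K, SiteSeqKey F (K₀ + K)) := Classical.decEq _
    ∃ δ : ℕ → ℝ, NE7.Core 1 1 (classSet₁₃ θ K₀ g₀) (badClass₁₃ θ K₀ g₀ jcut) (fun K t x => weightA₁₃ θ hP K₀ g₀ os K t x - (sh F θ hP g₀ os).1 K t x)
      (fun K t x => weightB₁₃ θ hP K₀ g₀ os K t x - (sh F θ hP g₀ os).2 K t x) δ ∧ Summable δ := by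
  letI : DecidableEq (Σ K, SiteSeqKey F (K₀ + K)) := Classical.decEq _
  have hA := (mgfForm_weightA₁₃ θ K₀ hP E hsel hζm hζ0 g₀ os).sub hshA hleA
  have hB := (mgfForm_weightB₁₃ θ K₀ hP E hsel hζm hζ0 g₀ os).sub hshB hleB
  have h := tiltedMeanMatching_of_tv_atKeys (T := classSet₁₃ θ K₀ g₀) (Bad := badClass₁₃ θ K₀ g₀ jcut) (l₀ := 1) (ρ := ρ)
    (kA := fun K => K₀ + K) (kB := fun K => K₀ + K + 1) (νA := fun K x => classMeasA₁₃ θ K₀ g₀ K x - νshA K x) (νB := fun K x => classMeasB₁₃ θ K₀ g₀ K x - νshB K x)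
    (T4RunLadder.unitFactorisation (datumOfRecord₁₃CoPH F N θ hP) (isPrintedAveraged_datumOfRecord₁₃CoPH F N θ hP).avgMeasurable g₀) os hA.finite hB.finite hTV
  have hη : TiltedMeanMatching 1 (classSet₁₃ θ K₀ g₀) (badClass₁₃ θ K₀ g₀ jcut)
      (fun K (U : GaugeField (F.P (K₀ + K)) 0 (Node00.SU N)) => T4GenFunBounds.prodObs ((datumOfRecord₁₃CoPH F N θ hP).scheme g₀) (K₀ + K) os U)
      (fun K x => classMeasA₁₃ θ K₀ g₀ K x - νshA K x)
      (fun K (U : GaugeField (F.P (K₀ + K + 1)) 0 (Node00.SU N)) => T4GenFunBounds.prodObs ((datumOfRecord₁₃CoPH F N θ hP).scheme g₀) (K₀ + K + 1) os U)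
      (fun K x => classMeasB₁₃ θ K₀ g₀ K x - νshB K x) fun K => 4 * Real.exp (2 * 1) * ρ K := by
    intro K t ht x hx u hu
    exact h K t ht x hx u hu
  exact coreEdge_of_coreZero_mgfForm one_pos hA hB h0 hδ₀ hη (hρs.mul_left _)

/-- **★★ … AT THE READING ITSELF, CANONICAL RATE** [bookkeeping]: under the same displayed hypotheses, N19′'s face AND U4′'s summability AT `crOfRecord₁₃At K₀ jcut sh …`'s OWN
carriers and CANONICAL `δ = deltaCan …` — dag-n20-d's transfer `core_crOfRecord₁₃At` BY NAME; its non-negative-core letter `hP0` is FREE on this road (a shell-free core in MGF-part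
form is an MGF over a difference measure, `MGFForm.nonneg'`).  What K3⁷ v2 stub 2's `KeyedCoreEdgeHolderD4` conjunct asks at a live tuple, from (V) + (SH) + U3's (I). [folklore] -/
theorem core_crOfRecord₁₃At_of_coreZero_of_tv (E : B12.RunParams → ℝ) (hsel : θ.ppSel = ppSelLiveOfRecord F N θ.ν θ.τ9 E (wOfRecord₉ F N θ.toStage9Params))
    (hζm : ZetaMeasurable F N θ.ζ) (hζ0 : ∀ p g k s Pl Ql RS U V', 0 ≤ θ.ζ p g k s Pl Ql RS U V') (g₀ : ℕ → ℝ) (os : List (ULoop F)) {δ₀ ρ : ℕ → ℝ}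
    (h0 : letI : DecidableEq (Σ K, SiteSeqKey F (K₀ + K)) := Classical.decEq _
      NE7.Core 1 1 (classSet₁₃ θ K₀ g₀) (badClass₁₃ θ K₀ g₀ jcut) (fun K _ x => weightA₁₃ θ hP K₀ g₀ os K 0 x - (sh F θ hP g₀ os).1 K 0 x)
        (fun K _ x => weightB₁₃ θ hP K₀ g₀ os K 0 x - (sh F θ hP g₀ os).2 K 0 x) δ₀)
    (hδ₀ : Summable δ₀)
    {νshA : ∀ K, (Σ K, SiteSeqKey F (K₀ + K)) → Measure (GaugeField (F.P (K₀ + K)) 0 (Node00.SU N))}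
    {νshB : ∀ K, (Σ K, SiteSeqKey F (K₀ + K)) → Measure (GaugeField (F.P (K₀ + K + 1)) 0 (Node00.SU N))}
    (hshA : MGFForm 1 (classSet₁₃ θ K₀ g₀)
      (fun K (U : GaugeField (F.P (K₀ + K)) 0 (Node00.SU N)) => T4GenFunBounds.prodObs ((datumOfRecord₁₃CoPH F N θ hP).scheme g₀) (K₀ + K) os U) νshA (sh F θ hP g₀ os).1)
    (hleA : ∀ K, ∀ x ∈ classSet₁₃ θ K₀ g₀ K, νshA K x ≤ classMeasA₁₃ θ K₀ g₀ K x)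
    (hshB : MGFForm 1 (classSet₁₃ θ K₀ g₀)
      (fun K (U : GaugeField (F.P (K₀ + K + 1)) 0 (Node00.SU N)) => T4GenFunBounds.prodObs ((datumOfRecord₁₃CoPH F N θ hP).scheme g₀) (K₀ + K + 1) os U) νshB (sh F θ hP g₀ os).2)
    (hleB : ∀ K, ∀ x ∈ classSet₁₃ θ K₀ g₀ K, νshB K x ≤ classMeasB₁₃ θ K₀ g₀ K x)
    (hTV : letI : DecidableEq (Σ K, SiteSeqKey F (K₀ + K)) := Classical.decEq _
      ∀ (K : ℕ) (t : ℝ), |t| ≤ 1 → ∀ x ∈ classSet₁₃ θ K₀ g₀ K \ badClass₁₃ θ K₀ g₀ jcut K t, ∀ S : Set (GaugeField (F.P 0) 0 (Node00.SU N)), MeasurableSet S →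
        |((classMeasB₁₃ θ K₀ g₀ K x - νshB K x).map
              ((T4RunLadder.unitFactorisation (datumOfRecord₁₃CoPH F N θ hP) (isPrintedAveraged_datumOfRecord₁₃CoPH F N θ hP).avgMeasurable g₀).A (K₀ + K + 1))).real S /
            ((classMeasB₁₃ θ K₀ g₀ K x - νshB K x).map
              ((T4RunLadder.unitFactorisation (datumOfRecord₁₃CoPH F N θ hP) (isPrintedAveraged_datumOfRecord₁₃CoPH F N θ hP).avgMeasurable g₀).A (K₀ + K + 1))).real Set.univ -
          ((classMeasA₁₃ θ K₀ g₀ K x - νshA K x).map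
              ((T4RunLadder.unitFactorisation (datumOfRecord₁₃CoPH F N θ hP) (isPrintedAveraged_datumOfRecord₁₃CoPH F N θ hP).avgMeasurable g₀).A (K₀ + K))).real S /
            ((classMeasA₁₃ θ K₀ g₀ K x - νshA K x).map
              ((T4RunLadder.unitFactorisation (datumOfRecord₁₃CoPH F N θ hP) (isPrintedAveraged_datumOfRecord₁₃CoPH F N θ hP).avgMeasurable g₀).A (K₀ + K))).real Set.univ| ≤
          ρ K)
    (hρs : Summable ρ) :
    (letI := (crOfRecord₁₃At K₀ jcut sh F θ hP g₀ os).dec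
     NE7.Core (crOfRecord₁₃At K₀ jcut sh F θ hP g₀ os).l₀ (crOfRecord₁₃At K₀ jcut sh F θ hP g₀ os).vol (crOfRecord₁₃At K₀ jcut sh F θ hP g₀ os).T
      (crOfRecord₁₃At K₀ jcut sh F θ hP g₀ os).Bad
      (fun K t τ => (crOfRecord₁₃At K₀ jcut sh F θ hP g₀ os).A K t τ - (crOfRecord₁₃At K₀ jcut sh F θ hP g₀ os).shA K t τ)
      (fun K t τ => (crOfRecord₁₃At K₀ jcut sh F θ hP g₀ os).B K t τ - (crOfRecord₁₃At K₀ jcut sh F θ hP g₀ os).shB K t τ)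
      (crOfRecord₁₃At K₀ jcut sh F θ hP g₀ os).δ) ∧ Summable (crOfRecord₁₃At K₀ jcut sh F θ hP g₀ os).δ := by
  letI : DecidableEq (Σ K, SiteSeqKey F (K₀ + K)) := Classical.decEq _
  obtain ⟨δ, hcore, hδ⟩ := coreEdge_reading₁₃_of_coreZero_of_tv θ hP K₀ jcut sh E hsel hζm hζ0 g₀ os h0 hδ₀ hshA hleA hshB hleB hTV hρs
  have hA := (mgfForm_weightA₁₃ θ K₀ hP E hsel hζm hζ0 g₀ os).sub hshA hleA
  exact core_crOfRecord₁₃At K₀ jcut sh θ hP g₀ os (fun K t _ x hx => hA.nonneg' K t (Finset.mem_sdiff.1 hx).1) hcore hδ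

end Edge

end YMDAG.N14.AtSpineReading13CoPH

end
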